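import Summits.ResolutionOfSingularities.ResolutionOfSingularities.Theorems.FrobeniusClosingSteerEtaleWindowLift
import Summits.ResolutionOfSingularities.ResolutionOfSingularities.Theorems.FrobeniusClosingSteerEtaleTowerChain
import HarnessLib

/-!
# [OURS · L0 W4.1] K3ᴳ (F3): the LEVELS of the étale tower over an ℕ-chain — polynomials `Pₘ`, kernels `𝔫ₘ`, local rings `Tₘ`, injective steps `gₘ`
# (chain W4.1 `FrobeniusClosingSteer`, crux stmt-ResolutionOfSingularities-16345; K3ᴳ = `K3GTarget.horizonBaseChange`, res-L0-w41-stub-2 signature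
# 8151858124874f54; `--supports … --as helper`)

HONEST FRAMING. OURS kernel (HIRONAKA-L librarian res-D-lib-1 gen 8). The ℕ-indexed analogue of the tower of `…EtaleWindowLift`: for a chain
`S 0 ≺ S 1 ≺ ⋯ ⊆ L` of dominated local subrings, a polynomial `P ∈ (S 0)[X]`, a field `k′` with COMPATIBLE maps `ψ m : κ(S m) → k′` and a root `θ ∈ k′` of `P`:
* `Ptower m ∈ (S m)[X]` — `P` pushed up the chain (recursive, so that `Ptower (m+1)` IS `(Ptower m).map incl`), monic / separable reduction / `Ptower m (θ) = 0`;
* `kerT m := 𝔫ₘ = ker (S m[X]/(Pₘ) → k′, X ↦ θ)` (maximal), `ιT m` the change of rings, **`kerT_eq_comap`** `𝔫ₘ = ιₘ⁻¹ 𝔫ₘ₊₁`;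
* `gT m : Tₘ → Tₘ₊₁` (`Tₘ := (S m[X]/(Pₘ))_𝔫ₘ`, `Localization.localRingHom`), `gT_comp`, **`injective_gT`** (regular members), `isRegularLocalRing_T`, `isDomain_T`;
* `residue_inclusion_eq` — the compatibility of the `ψ`'s along all inclusions `S i ≤ S j`.
All per-level facts are the tree's two-level lemmas (`…EtaleWindowStep`, `…EtaleWindowLift`) instantiated at `S m ≺ S (m+1)`.
Nothing here is a statement of H. Hironaka's manuscript [Hironaka2017]. AI-written; AI review is weaker than expert review. [folklore]
-/

set_option linter.dupNamespace false

noncomputable section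

namespace Summit.ResolutionOfSingularities.ResolutionOfSingularities.Theorems.SwitchingDichotomy.EtaleTower

open IsLocalRing Polynomial Literature.AlgebraicGeometry.Resolution
open Summit.ResolutionOfSingularities.ResolutionOfSingularities.Theorems.SwitchingDichotomy.EtaleLift

variable {L : Type} [Field L] (S : ℕ → Subring L) (hdom : ∀ m, SubringDominates (S m) (S (m + 1)))

/-! ## §1 The tower of polynomials -/

/-- `P` pushed up the chain: `Ptower 0 = P`, `Ptower (m+1) = (Ptower m).map (S m ↪ S (m+1))`. [invented: ours] -/
def Ptower (P : (S 0)[X]) : ∀ m : ℕ, (S m)[X]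
  | 0 => P
  | m + 1 => (Ptower P m).map (Subring.inclusion (hdom m).1)

variable (P : (S 0)[X])

/-- Unfolding at `0`. [folklore] -/
@[simp] theorem Ptower_zero : Ptower S hdom P 0 = P := rfl

/-- Unfolding at a successor. [folklore] -/
theorem Ptower_succ (m : ℕ) : Ptower S hdom P (m + 1) = (Ptower S hdom P m).map (Subring.inclusion (hdom m).1) := rfl

/-- Every `Ptower m` is monic. [folklore] -/
theorem monic_Ptower (hP : P.Monic) : ∀ m, (Ptower S hdom P m).Monic
  | 0 => hP
  | m + 1 => (monic_Ptower hP m).map _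

variable [∀ m, IsLocalRing (S m)]

/-- Every `Ptower m` has separable reduction. [folklore] -/
theorem separable_Ptower (hsep : (P.map (residue (S 0))).Separable) : ∀ m, ((Ptower S hdom P m).map (residue (S m))).Separable
  | 0 => hsep
  | m + 1 => separable_map_inclusion (hdom m) (Ptower S hdom P m) (separable_Ptower hsep m)

/-! ## §2 Compatible residue maps and the root relation at every level -/

section Kernels

variable {k' : Type} [Field k']

/-- **Compatibility of a family `ψ m : κ(S m) → k′`** with the residue maps of the inclusions `S m ≤ S (m+1)`. [invented: ours] -/
def IsCompat (ψ : ∀ m, ResidueField (S m) →+* k') : Prop :=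
  ∀ m, haveI := isLocalHom_inclusion_of_subringDominates (hdom m);
    (ψ (m + 1)).comp (ResidueField.map (Subring.inclusion (hdom m).1)) = ψ m

variable (ψ : ∀ m, ResidueField (S m) →+* k') (hψ : IsCompat S hdom ψ) (θ : k') (hθ₀ : P.eval₂ ((ψ 0).comp (residue (S 0))) θ = 0)

include hψ in
/-- One step of compatibility, read on `S m`: `ψ (m+1) ∘ residue ∘ incl = ψ m ∘ residue`. [folklore] -/
theorem comp_residue_comp_inclusion (m : ℕ) :
    ((ψ (m + 1)).comp (residue (S (m + 1)))).comp (Subring.inclusion (hdom m).1) = (ψ m).comp (residue (S m)) := by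
  haveI := isLocalHom_inclusion_of_subringDominates (hdom m)
  ext s
  have h := RingHom.congr_fun (hψ m) (residue (S m) s)
  simp only [RingHom.comp_apply, ResidueField.map_residue] at h
  simpa only [RingHom.comp_apply] using h

include hψ in
/-- Compatibility along all inclusions `S i ≤ S j`, elementwise. [folklore] -/
theorem residue_inclusion_eq {i j : ℕ} (h : i ≤ j) (s : S i) :
    ψ j (residue (S j) ⟨(s : L), monotone_nat_of_le_succ (fun m => (hdom m).1) h s.2⟩) = ψ i (residue (S i) s) := by
  induction j, h using Nat.le_induction with
  | base => rfl
  | succ j h ih =>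
    rw [← ih]
    exact RingHom.congr_fun (comp_residue_comp_inclusion S hdom ψ hψ j) ⟨(s : L), monotone_nat_of_le_succ (fun m => (hdom m).1) h s.2⟩

include hψ hθ₀ in
/-- **The root relation at every level**: `Ptower m (θ) = 0` through `ψ m ∘ residue`. [folklore] -/
theorem eval₂_Ptower : ∀ m, (Ptower S hdom P m).eval₂ ((ψ m).comp (residue (S m))) θ = 0
  | 0 => hθ₀
  | m + 1 => by
    rw [Ptower_succ, Polynomial.eval₂_map, comp_residue_comp_inclusion S hdom ψ hψ m]
    exact eval₂_Ptower m


/-! ## §3 Kernels, changes of rings, local maps -/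

/-- **`𝔫ₘ`**: the kernel of `S m[X]/(Pₘ) → k′`, `X ↦ θ`. [invented: ours] -/
abbrev kerT (m : ℕ) : Ideal (AdjoinRoot (Ptower S hdom P m)) :=
  RingHom.ker (AdjoinRoot.lift ((ψ m).comp (residue (S m))) θ (eval₂_Ptower S hdom P ψ hψ θ hθ₀ m))

/-- `𝔫ₘ` is maximal. [folklore] -/
theorem isMaximal_kerT (hP : P.Monic) (m : ℕ) : (kerT S hdom P ψ hψ θ hθ₀ m).IsMaximal :=
  isMaximal_ker_lift _ _ _ _ (monic_Ptower S hdom P hP m)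

/-- **`ιₘ : S m[X]/(Pₘ) → S (m+1)[X]/(Pₘ₊₁)`**, the change of rings. [invented: ours] -/
abbrev ιT (m : ℕ) : AdjoinRoot (Ptower S hdom P m) →+* AdjoinRoot (Ptower S hdom P (m + 1)) :=
  AdjoinRoot.lift ((AdjoinRoot.of (Ptower S hdom P (m + 1))).comp (Subring.inclusion (hdom m).1))
    (AdjoinRoot.root (Ptower S hdom P (m + 1))) (eval₂_root_map_eq_zero (Subring.inclusion (hdom m).1) (Ptower S hdom P m))

omit [∀ m, IsLocalRing (S m)] in
/-- `ιₘ` on the root: `ιₘ (xₘ) = xₘ₊₁`. [folklore] -/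
theorem ιT_root (m : ℕ) : ιT S hdom P m (AdjoinRoot.root (Ptower S hdom P m)) = AdjoinRoot.root (Ptower S hdom P (m + 1)) :=
  AdjoinRoot.lift_root _

omit [∀ m, IsLocalRing (S m)] in
/-- `ιₘ` on constants: `ιₘ (c) = incl c`. [folklore] -/
theorem ιT_of (m : ℕ) (c : S m) :
    ιT S hdom P m (AdjoinRoot.of (Ptower S hdom P m) c) = AdjoinRoot.of (Ptower S hdom P (m + 1)) (Subring.inclusion (hdom m).1 c) :=
  AdjoinRoot.lift_of _

/-- The value of `(S (m+1)[X]/(Pₘ₊₁) → k′) ∘ ιₘ` on a class `[q]`, `q ∈ S m[X]` (tower spelling of `EtaleLift.lift_liftMap_mk`). [folklore] -/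
theorem lift_ιT_mk (m : ℕ) (q : (S m)[X]) :
    haveI := isLocalHom_inclusion_of_subringDominates (hdom m)
    AdjoinRoot.lift ((ψ (m + 1)).comp (residue (S (m + 1)))) θ (eval₂_Ptower S hdom P ψ hψ θ hθ₀ (m + 1))
        (ιT S hdom P m (AdjoinRoot.mk (Ptower S hdom P m) q)) =
      q.eval₂ (((ψ (m + 1)).comp (ResidueField.map (Subring.inclusion (hdom m).1))).comp (residue (S m))) θ :=
  lift_liftMap_mk (hdom m) (Ptower S hdom P m) (ψ (m + 1)) θ (eval₂_Ptower S hdom P ψ hψ θ hθ₀ (m + 1)) q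

/-- The two lifts at level `m` — through `ψ m` and through `ψ (m+1) ∘ κ(incl)` — coincide. [folklore] -/
theorem lift_eq_lift_comp (m : ℕ) :
    haveI := isLocalHom_inclusion_of_subringDominates (hdom m)
    AdjoinRoot.lift ((ψ m).comp (residue (S m))) θ (eval₂_Ptower S hdom P ψ hψ θ hθ₀ m) =
      AdjoinRoot.lift (((ψ (m + 1)).comp (ResidueField.map (Subring.inclusion (hdom m).1))).comp (residue (S m))) θ
        (eval₂_inclusion_of_eval₂ (hdom m) (Ptower S hdom P m) (ψ (m + 1)) θ (eval₂_Ptower S hdom P ψ hψ θ hθ₀ (m + 1))) := by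
  haveI := isLocalHom_inclusion_of_subringDominates (hdom m)
  refine RingHom.ext fun a => ?_
  obtain ⟨q, rfl⟩ := AdjoinRoot.mk_surjective a
  rw [AdjoinRoot.lift_mk, AdjoinRoot.lift_mk, hψ m]

/-- **`𝔫ₘ = ιₘ⁻¹ 𝔫ₘ₊₁`.** [folklore] -/
theorem kerT_eq_comap (m : ℕ) :
    kerT S hdom P ψ hψ θ hθ₀ m = (kerT S hdom P ψ hψ θ hθ₀ (m + 1)).comap (ιT S hdom P m) := by
  have h1 := ker_lift_eq_comap (hdom m) (Ptower S hdom P m) (ψ (m + 1)) θ (eval₂_Ptower S hdom P ψ hψ θ hθ₀ (m + 1))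
  refine Eq.trans ?_ h1
  change RingHom.ker _ = RingHom.ker _
  rw [lift_eq_lift_comp S hdom P ψ hψ θ hθ₀ m]

/-- **`gₘ : Tₘ → Tₘ₊₁`**, the local map over `ιₘ`. [invented: ours] -/
abbrev gT (m : ℕ) : Localization.AtPrime (kerT S hdom P ψ hψ θ hθ₀ m) →+* Localization.AtPrime (kerT S hdom P ψ hψ θ hθ₀ (m + 1)) :=
  Localization.localRingHom (kerT S hdom P ψ hψ θ hθ₀ m) (kerT S hdom P ψ hψ θ hθ₀ (m + 1)) (ιT S hdom P m)
    (kerT_eq_comap S hdom P ψ hψ θ hθ₀ m)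

/-- `gₘ` lies over `ιₘ`. [folklore] -/
theorem gT_comp (m : ℕ) :
    (gT S hdom P ψ hψ θ hθ₀ m).comp (algebraMap (AdjoinRoot (Ptower S hdom P m)) _) =
      (algebraMap (AdjoinRoot (Ptower S hdom P (m + 1))) _).comp (ιT S hdom P m) :=
  RingHom.ext fun a => Localization.localRingHom_to_map _ _ _ (kerT_eq_comap S hdom P ψ hψ θ hθ₀ m) a

/-- **`Tₘ` is a regular local ring** when `S m` is. [cite: StacksProject, Tag 00TV] -/
theorem isRegularLocalRing_T (hreg : ∀ m, IsRegularLocalRing (S m)) (hP : P.Monic) (hsep : (P.map (residue (S 0))).Separable) (m : ℕ) :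
    IsRegularLocalRing (Localization.AtPrime (kerT S hdom P ψ hψ θ hθ₀ m)) :=
  isRegularLocalRing_localization_ker_lift (Ptower S hdom P m) (ψ m) θ (eval₂_Ptower S hdom P ψ hψ θ hθ₀ m) (hreg m)
    (monic_Ptower S hdom P hP m) (separable_Ptower S hdom P hsep m)

/-- `Tₘ` is a domain when `S m` is regular. [folklore] -/
theorem isDomain_T (hreg : ∀ m, IsRegularLocalRing (S m)) (hP : P.Monic) (hsep : (P.map (residue (S 0))).Separable) (m : ℕ) :
    IsDomain (Localization.AtPrime (kerT S hdom P ψ hψ θ hθ₀ m)) :=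
  @isDomain_of_isRegularLocalRing _ _ (isRegularLocalRing_T S hdom P ψ hψ θ hθ₀ hreg hP hsep m)

/-- **`gₘ` is injective** (regular members). [cite: StacksProject, Tag 00TV] -/
theorem injective_gT (hreg : ∀ m, IsRegularLocalRing (S m)) (hP : P.Monic) (hsep : (P.map (residue (S 0))).Separable) (m : ℕ) :
    Function.Injective (gT S hdom P ψ hψ θ hθ₀ m) :=
  injective_liftHom' (hdom m) (Ptower S hdom P m) (ψ (m + 1)) θ (eval₂_Ptower S hdom P ψ hψ θ hθ₀ (m + 1)) (hreg m) (hreg (m + 1))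
    (monic_Ptower S hdom P hP m) (separable_Ptower S hdom P hsep m) _ (kerT_eq_comap S hdom P ψ hψ θ hθ₀ m)
    (gT S hdom P ψ hψ θ hθ₀ m) (gT_comp S hdom P ψ hψ θ hθ₀ m)

/-- The squares along `gₘ`: `gₘ (s) = incl s`. [folklore] -/
theorem gT_algebraMap (m : ℕ) (s : S m) :
    gT S hdom P ψ hψ θ hθ₀ m (algebraMap (S m) _ s) = algebraMap (S (m + 1)) _ (Subring.inclusion (hdom m).1 s) := by
  have h1 := RingHom.congr_fun (gT_comp S hdom P ψ hψ θ hθ₀ m) (AdjoinRoot.of (Ptower S hdom P m) s)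
  simp only [RingHom.comp_apply, AdjoinRoot.lift_of] at h1
  rw [IsScalarTower.algebraMap_apply (S m) (AdjoinRoot (Ptower S hdom P m)) _, AdjoinRoot.algebraMap_eq, h1,
    IsScalarTower.algebraMap_apply (S (m + 1)) (AdjoinRoot (Ptower S hdom P (m + 1))) _, AdjoinRoot.algebraMap_eq]

/-- The roots along `gₘ`: `gₘ (xₘ) = xₘ₊₁`. [folklore] -/
theorem gT_root (m : ℕ) :
    gT S hdom P ψ hψ θ hθ₀ m (algebraMap (AdjoinRoot (Ptower S hdom P m)) _ (AdjoinRoot.root (Ptower S hdom P m))) =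
      algebraMap (AdjoinRoot (Ptower S hdom P (m + 1))) _ (AdjoinRoot.root (Ptower S hdom P (m + 1))) := by
  have h1 := RingHom.congr_fun (gT_comp S hdom P ψ hψ θ hθ₀ m) (AdjoinRoot.root (Ptower S hdom P m))
  simp only [RingHom.comp_apply, AdjoinRoot.lift_root] at h1
  exact h1

end Kernels

end Summit.ResolutionOfSingularities.ResolutionOfSingularities.Theorems.SwitchingDichotomy.EtaleTower

end
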